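import Literature.NumberTheory.Transcendental.RoySmallValuePhi
import Mathlib.LinearAlgebra.Matrix.NonsingularInverse
import Mathlib.Data.Sym.Card
import HarnessLib

/-!
# Roy's small value estimate for `𝔾ₐ × 𝔾ₘ` — vanishing and non-vanishing of `Φ` (Theorem 5.2, proof)

Topic `Literature/NumberTheory/Transcendental`. Part of the formalisation of the proof of Roy 2013,
Theorem 1.1 (named fact `roy2013_thm_1_1`, `RoySmallValueEstimates.lean`). Source: D. Roy,
*A small value estimate for `𝔾ₐ × 𝔾ₘ`*, Mathematika 59 (2013) 333–363 = arXiv:1301.0663, §5,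
proof of Theorem 5.2 (p. 14 of the arXiv text):

> By Lemma 5.1, the polynomial map `Φ : (ℂ[X]_D)³ → ℂ`, `Φ(Q) = det(φ_Q)`, does not vanish at
> `P` [...]. Since `Φ` vanishes at each point `Q` with `dim_ℂ(ℂ[X]/(Q)) > 0`, Φ is divisible by
> the resultant.

Here, for the determinant `Φ = royPhi` of `RoySmallValuePhi.lean` (columns labelled by the
monomials of degree `2D` and by two sets `M₁, M₂` of monomials of degree `2D`):

* `royPhi_eq_zero_of_common_zero` — **(Φ1)** if `Q₀, Q₁, Q₂ ∈ ℂ[X]_D` have a common zero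
  `α ≠ 0` then `Φ(Q) = 0` (otherwise `A ↦ ΣAᵢQᵢ` would be onto `ℂ[X]_{3D} ∋ X_j^{3D}`);
* `royPhi_ne_zero` — **(Φ3)** under the hypotheses of Lemma 5.1 (`(P, Q, R)` "regular") and with
  `E₁ = ⟨X^μ : μ ∈ M₁⟩`, `E₂ = ⟨X^μ : μ ∈ M₂⟩` complements as in Lemma 5.1, `Φ(P, Q, R) ≠ 0`;
* `exists_phi_data` — existence of such `M₁, M₂` and of a bijection columns ≃ rows
  (dimension count `s(2D) + (s(2D) − s(D)) + D² = s(3D)`, `s(n) = binom(n+2, 2)`).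

Everything here is proved; no new definitions, no new named facts.

## References

* [Roy2013] D. Roy, *A small value estimate for 𝔾ₐ × 𝔾ₘ*, Mathematika 59 (2013), 333–363
  (arXiv:1301.0663), §5, Lemma 5.1, Theorem 5.2.
-/

noncomputable section

open MvPolynomial Finset Module Matrix

namespace Literature.NumberTheory.Transcendental

namespace Roy2013

variable {D : ℕ} {M₁ M₂ : Finset (Fin 3 →₀ ℕ)}

/-! ### Bookkeeping -/

/-- `#{e ∈ ℕ³ : |e| = n} = binom(n+2, 2)` (stars and bars). [folklore] -/
theorem card_finsuppAntidiag_fin_three (n : ℕ) :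
    Fintype.card ↥(finsuppAntidiag (univ : Finset (Fin 3)) n) = (n + 2).choose 2 := by
  classical
  have e : ↥(finsuppAntidiag (univ : Finset (Fin 3)) n) ≃ Sym (Fin 3) n :=
    (Equiv.subtypeEquivRight (fun d => by
      change _ ↔ (d.sum (fun _ => id) = n)
      rw [mem_finsuppAntidiag, Finsupp.sum_fintype _ _ (fun _ => rfl)]
      simp only [Finset.subset_univ, and_true, id])).trans
      (Sym.equivNatSum (α := Fin 3) (n := n)).symm
  rw [Fintype.card_congr e, Sym.card_sym_eq_choose, Fintype.card_fin,
    show 3 + n - 1 = n + 2 by omega]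
  exact Nat.choose_symm_add

/-- Exponents in `finsuppAntidiag univ n` have degree `n`. [folklore] -/
theorem degree_of_mem_finsuppAntidiag {n : ℕ} {μ : Fin 3 →₀ ℕ}
    (h : μ ∈ finsuppAntidiag (univ : Finset (Fin 3)) n) : μ.degree = n := by
  rw [mem_finsuppAntidiag] at h
  rw [Finsupp.degree_eq_sum]; exact h.1

/-- `colExp c` has degree `2D`. [cite: Roy2013, §5, proof of Theorem 5.2] -/
theorem degree_colExp (hM₁ : ∀ μ ∈ M₁, μ.degree = 2 * D) (hM₂ : ∀ μ ∈ M₂, μ.degree = 2 * D)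
    (c : ↥(finsuppAntidiag (univ : Finset (Fin 3)) (2 * D)) ⊕ (↥M₁ ⊕ ↥M₂)) :
    (colExp c).degree = 2 * D := by
  rcases c with μ | μ | μ
  · exact degree_of_mem_finsuppAntidiag μ.2
  · exact hM₁ _ μ.2
  · exact hM₂ _ μ.2

/-- Coefficients of a combination of distinct monomials. [folklore] -/
theorem coeff_sum_smul_monomial (S : Finset (Fin 3 →₀ ℕ)) (b : ↥S → ℂ) (μ : ↥S) :
    coeff μ.1 (∑ μ' : ↥S, b μ' • monomial μ'.1 (1 : ℂ)) = b μ := by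
  classical
  rw [coeff_sum, Finset.sum_eq_single μ]
  · rw [coeff_smul, coeff_monomial, if_pos rfl, smul_eq_mul, mul_one]
  · intro μ' _ hμ'
    rw [coeff_smul, coeff_monomial, if_neg (fun h => hμ' (Subtype.ext h)), smul_zero]
  · exact fun h => absurd (Finset.mem_univ μ) h

/-- Reindexing the columns commutes with `mulVec`. [folklore] -/
theorem reindex_mulVec {m n : Type*} [Fintype m] [Fintype n] (M : Matrix m n ℂ) (σ : n ≃ m)
    (a' : m → ℂ) : (M.reindex (Equiv.refl _) σ).mulVec a' = M.mulVec (a' ∘ σ) := by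
  ext e
  simp only [Matrix.mulVec, dotProduct, Matrix.reindex_apply, Matrix.submatrix_apply,
    Equiv.refl_symm, Equiv.refl_apply, Function.comp_apply]
  exact (Equiv.sum_comp σ (fun r => M e (σ.symm r) * a' r)).symm.trans
    (Fintype.sum_congr _ _ fun c => by simp)

/-- `φ_Q(A) = A₀Q₀ + A₁Q₁ + A₂Q₂` with `Aᵢ` the polynomial whose coordinates are the `i`-th block
of `a`. [cite: Roy2013, §5, proof of Theorem 5.2] -/
theorem combo_eq_blocks (Qs : Fin 3 → CX)
    (a : ↥(finsuppAntidiag (univ : Finset (Fin 3)) (2 * D)) ⊕ (↥M₁ ⊕ ↥M₂) → ℂ) :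
    combo Qs a =
      (∑ μ : ↥(finsuppAntidiag (univ : Finset (Fin 3)) (2 * D)),
          a (Sum.inl μ) • monomial μ.1 (1 : ℂ)) * Qs 0 +
        ((∑ μ : ↥M₁, a (Sum.inr (Sum.inl μ)) • monomial μ.1 (1 : ℂ)) * Qs 1 +
          (∑ μ : ↥M₂, a (Sum.inr (Sum.inr μ)) • monomial μ.1 (1 : ℂ)) * Qs 2) := by
  rw [combo, Fintype.sum_sum_type, Fintype.sum_sum_type]
  simp only [colExp, colBlock, Sum.elim_inl, Sum.elim_inr, Finset.sum_mul, smul_mul_assoc]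

/-- Evaluation kills `φ_Q(A)` at a common zero of the `Qᵢ`. [cite: Roy2013, §5, proof of Theorem 5.2] -/
theorem aeval_combo_eq_zero (Qs : Fin 3 → CX) {α : Fin 3 → ℂ} (hαQ : ∀ i, aeval α (Qs i) = 0)
    (a : ↥(finsuppAntidiag (univ : Finset (Fin 3)) (2 * D)) ⊕ (↥M₁ ⊕ ↥M₂) → ℂ) :
    aeval α (combo Qs a) = 0 := by
  rw [combo, map_sum]
  exact Finset.sum_eq_zero fun c _ => by rw [map_smul, map_mul, hαQ, mul_zero, smul_zero]

/-! ### (Φ1) `Φ` vanishes at triples with a common zero -/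

/-- **(Φ1)** If `Q₀, Q₁, Q₂ ∈ ℂ[X]_D` have a common projective zero `α ≠ 0` then `Φ(Q) = 0`.
[cite: Roy2013, §5, proof of Theorem 5.2 ("Φ vanishes at each point `Q` of `(ℂ[X]_D)³` with
`dim_ℂ ℂ[X]/(Q) > 0`")] -/
theorem royPhi_eq_zero_of_common_zero (hM₁ : ∀ μ ∈ M₁, μ.degree = 2 * D)
    (hM₂ : ∀ μ ∈ M₂, μ.degree = 2 * D)
    (σ : (↥(finsuppAntidiag (univ : Finset (Fin 3)) (2 * D)) ⊕ (↥M₁ ⊕ ↥M₂)) ≃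
      ↥(finsuppAntidiag (univ : Finset (Fin 3)) (3 * D)))
    {Qs : Fin 3 → CX} (hQh : ∀ i, (Qs i).IsHomogeneous D) {α : Fin 3 → ℂ} (hα : α ≠ 0)
    (hαQ : ∀ i, aeval α (Qs i) = 0) : royPhi D M₁ M₂ σ Qs = 0 := by
  classical
  by_contra hne
  set A : Matrix _ _ ℂ := (royMatrix D M₁ M₂ Qs).reindex (Equiv.refl _) σ with hA
  have hunit : IsUnit A := (Matrix.isUnit_iff_isUnit_det A).mpr (isUnit_iff_ne_zero.mpr hne)
  have hsurj := Matrix.mulVec_surjective_iff_isUnit.mpr hunit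
  apply hα
  funext j
  -- `X_j^{3D}` is in the image: `X_j^{3D} = Σ Aᵢ Qᵢ`, and evaluating at `α` gives `α_j^{3D} = 0`.
  have hej : Finsupp.single j (3 * D) ∈ finsuppAntidiag (univ : Finset (Fin 3)) (3 * D) := by
    rw [mem_finsuppAntidiag]
    exact ⟨by simp [Finsupp.single_apply], Finset.subset_univ _⟩
  obtain ⟨a', ha'⟩ := hsurj (Pi.single ⟨Finsupp.single j (3 * D), hej⟩ 1)
  rw [hA, reindex_mulVec] at ha'
  have hcombo : combo Qs (a' ∘ σ) = monomial (Finsupp.single j (3 * D)) (1 : ℂ) := by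
    rw [← sub_eq_zero]
    refine eq_zero_of_coeff_row_eq_zero ((isHomogeneous_combo hQh hM₁ hM₂ _).sub
      (isHomogeneous_monomial _ (by rw [Finsupp.degree_single]))) fun e => ?_
    rw [coeff_sub, coeff_combo, ha', coeff_monomial, sub_eq_zero]
    by_cases h : Finsupp.single j (3 * D) = e.1
    · rw [if_pos h, show e = ⟨Finsupp.single j (3 * D), hej⟩ from Subtype.ext h.symm,
        Pi.single_eq_same]
    · rw [if_neg h, Pi.single_eq_of_ne (fun h' => h (congrArg Subtype.val h').symm)]
  have h := aeval_combo_eq_zero Qs hαQ (a' ∘ σ)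
  rw [hcombo, aeval_monomial, map_one, one_mul,
    Finsupp.prod_single_index (h := fun i k => α i ^ k) (pow_zero _)] at h
  exact (pow_eq_zero_iff'.mp h).1

/-! ### (Φ3) `Φ(P, Q, R) ≠ 0` for a regular sequence -/

/-- **(Φ3)** Under the hypotheses of Lemma 5.1, with `E₁, E₂` spanned by the monomials with
exponents in `M₁, M₂`, `Φ(P, Q, R) ≠ 0`: the map `A ↦ A₀P + A₁Q + A₂R` is injective on
`ℂ[X]_{2D} × E₁ × E₂`, so `M_{(P,Q,R)}` has trivial kernel. [cite: Roy2013, §5, proof of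
Theorem 5.2 ("By Lemma 5.1, `Φ` does not vanish at `P`")] -/
theorem royPhi_ne_zero {P Q R : CX} (hP : P.IsHomogeneous D) (hQ : Q.IsHomogeneous D)
    (hR : R.IsHomogeneous D) (hP0 : P ≠ 0) (hQ0 : Q ≠ 0)
    (hPQ : ∀ f : CX, Q * f ∈ Ideal.span {P} → f ∈ Ideal.span {P})
    (hPQR : ∀ f : CX, R * f ∈ Ideal.span {P, Q} → f ∈ Ideal.span {P, Q})
    (hM₁ : ∀ μ ∈ M₁, μ.degree = 2 * D) (hM₂ : ∀ μ ∈ M₂, μ.degree = 2 * D)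
    (hE₁i : Submodule.span ℂ ((fun μ => monomial μ (1 : ℂ)) '' (M₁ : Set (Fin 3 →₀ ℕ))) ⊓
      (homogeneousSubmodule (Fin 3) ℂ D).map (LinearMap.mulLeft ℂ P) = ⊥)
    (hE₁s : Submodule.span ℂ ((fun μ => monomial μ (1 : ℂ)) '' (M₁ : Set (Fin 3 →₀ ℕ))) ⊔
      (homogeneousSubmodule (Fin 3) ℂ D).map (LinearMap.mulLeft ℂ P) =
      homogeneousSubmodule (Fin 3) ℂ (2 * D))
    (hE₂i : Submodule.span ℂ ((fun μ => monomial μ (1 : ℂ)) '' (M₂ : Set (Fin 3 →₀ ℕ))) ⊓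
      ((homogeneousSubmodule (Fin 3) ℂ D).map (LinearMap.mulLeft ℂ P) ⊔
        (homogeneousSubmodule (Fin 3) ℂ D).map (LinearMap.mulLeft ℂ Q)) = ⊥)
    (hE₂s : Submodule.span ℂ ((fun μ => monomial μ (1 : ℂ)) '' (M₂ : Set (Fin 3 →₀ ℕ))) ⊔
      ((homogeneousSubmodule (Fin 3) ℂ D).map (LinearMap.mulLeft ℂ P) ⊔
        (homogeneousSubmodule (Fin 3) ℂ D).map (LinearMap.mulLeft ℂ Q)) =
      homogeneousSubmodule (Fin 3) ℂ (2 * D))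
    (σ : (↥(finsuppAntidiag (univ : Finset (Fin 3)) (2 * D)) ⊕ (↥M₁ ⊕ ↥M₂)) ≃
      ↥(finsuppAntidiag (univ : Finset (Fin 3)) (3 * D))) :
    royPhi D M₁ M₂ σ ![P, Q, R] ≠ 0 := by
  classical
  set E₁ : Submodule ℂ CX :=
    Submodule.span ℂ ((fun μ => monomial μ (1 : ℂ)) '' (M₁ : Set (Fin 3 →₀ ℕ))) with hE₁def
  set E₂ : Submodule ℂ CX :=
    Submodule.span ℂ ((fun μ => monomial μ (1 : ℂ)) '' (M₂ : Set (Fin 3 →₀ ℕ))) with hE₂def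
  have hspan_le : ∀ M : Finset (Fin 3 →₀ ℕ), (∀ μ ∈ M, μ.degree = 2 * D) →
      Submodule.span ℂ ((fun μ => monomial μ (1 : ℂ)) '' (M : Set (Fin 3 →₀ ℕ))) ≤
        homogeneousSubmodule (Fin 3) ℂ (2 * D) := fun M hM =>
    Submodule.span_le.mpr (by
      rintro _ ⟨μ, hμ, rfl⟩
      exact (mem_homogeneousSubmodule _ _).mpr (isHomogeneous_monomial _ (hM μ hμ)))
  obtain ⟨hker, -, -⟩ := lemma_5_1 hP hQ hR hP0 hQ0 hPQ hPQR (hspan_le M₁ hM₁) hE₁i hE₁s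
    (hspan_le M₂ hM₂) hE₂i hE₂s
  set A : Matrix _ _ ℂ := (royMatrix D M₁ M₂ ![P, Q, R]).reindex (Equiv.refl _) σ with hA
  rw [royPhi, ← isUnit_iff_ne_zero, ← Matrix.isUnit_iff_isUnit_det, ← hA,
    ← Matrix.mulVec_injective_iff_isUnit, ← Matrix.coe_mulVecLin, ← LinearMap.ker_eq_bot,
    LinearMap.ker_eq_bot']
  intro a' ha'
  rw [Matrix.mulVecLin_apply, hA, reindex_mulVec] at ha'
  set a := a' ∘ σ with hadef
  -- `φ(A₀, A₁, A₂) = combo a = 0`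
  have hcombo : combo ![P, Q, R] a = 0 :=
    eq_zero_of_coeff_row_eq_zero (isHomogeneous_combo (Fin.forall_fin_succ.mpr
      ⟨hP, Fin.forall_fin_two.mpr ⟨hQ, hR⟩⟩) hM₁ hM₂ a) fun e => by
      rw [coeff_combo, ha', Pi.zero_apply]
  set A₀ : CX := ∑ μ : ↥(finsuppAntidiag (univ : Finset (Fin 3)) (2 * D)),
    a (Sum.inl μ) • monomial μ.1 (1 : ℂ) with hA₀
  set A₁ : CX := ∑ μ : ↥M₁, a (Sum.inr (Sum.inl μ)) • monomial μ.1 (1 : ℂ) with hA₁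
  set A₂ : CX := ∑ μ : ↥M₂, a (Sum.inr (Sum.inr μ)) • monomial μ.1 (1 : ℂ) with hA₂
  have hA₀m : A₀ ∈ homogeneousSubmodule (Fin 3) ℂ (2 * D) :=
    Submodule.sum_mem _ fun μ _ => Submodule.smul_mem _ _
      ((mem_homogeneousSubmodule _ _).mpr
        (isHomogeneous_monomial _ (degree_of_mem_finsuppAntidiag μ.2)))
  have hA₁m : A₁ ∈ E₁ := Submodule.sum_mem _ fun μ _ =>
    Submodule.smul_mem _ _ (Submodule.subset_span ⟨μ.1, Finset.mem_coe.mpr μ.2, rfl⟩)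
  have hA₂m : A₂ ∈ E₂ := Submodule.sum_mem _ fun μ _ =>
    Submodule.smul_mem _ _ (Submodule.subset_span ⟨μ.1, Finset.mem_coe.mpr μ.2, rfl⟩)
  have hzero : decompMap D P Q R E₁ E₂ (⟨A₀, hA₀m⟩, ⟨A₁, hA₁m⟩, ⟨A₂, hA₂m⟩) = 0 := by
    rw [decompMap_apply, ← hcombo, combo_eq_blocks]
    rfl
  have htriv := LinearMap.ker_eq_bot'.mp hker _ hzero
  have h0 : A₀ = 0 := by simpa using congrArg (fun x => (x.1 : CX)) htriv
  have h1 : A₁ = 0 := by simpa using congrArg (fun x => (x.2.1 : CX)) htriv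
  have h2 : A₂ = 0 := by simpa using congrArg (fun x => (x.2.2 : CX)) htriv
  have ha : a = 0 := by
    funext c
    rcases c with μ | μ | μ
    · have := coeff_sum_smul_monomial _ (fun μ => a (Sum.inl μ)) μ
      rw [← hA₀, h0, coeff_zero] at this
      exact this.symm
    · have := coeff_sum_smul_monomial _ (fun μ => a (Sum.inr (Sum.inl μ))) μ
      rw [← hA₁, h1, coeff_zero] at this
      exact this.symm
    · have := coeff_sum_smul_monomial _ (fun μ => a (Sum.inr (Sum.inr μ))) μ
      rw [← hA₂, h2, coeff_zero] at this
      exact this.symm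
  funext r
  have := congr_fun ha (σ.symm r)
  rw [hadef, Function.comp_apply, Equiv.apply_symm_apply] at this
  exact this

/-! ### Existence of the complements `E₁, E₂` and of `σ` -/

/-- The span of the monomials with exponents in `M` has dimension `#M`. [folklore] -/
theorem finrank_span_monomials (M : Finset (Fin 3 →₀ ℕ)) :
    finrank ℂ (Submodule.span ℂ ((fun μ => monomial μ (1 : ℂ)) '' (M : Set (Fin 3 →₀ ℕ)))) =
      M.card := by
  classical
  have hli : LinearIndependent ℂ (fun μ : ↥M => monomial μ.1 (1 : ℂ)) := by
    have h := (MvPolynomial.basisMonomials (Fin 3) ℂ).linearIndependent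
    rw [coe_basisMonomials] at h
    exact h.comp (fun μ : ↥M => μ.1) Subtype.val_injective
  rw [Set.image_eq_range, show (fun μ : ↥(M : Set (Fin 3 →₀ ℕ)) => monomial μ.1 (1 : ℂ)) =
    fun μ : ↥M => monomial μ.1 (1 : ℂ) from rfl, finrank_span_eq_card hli, Fintype.card_coe]

/-- **Existence of the data of `Φ_{P,Q}`**: for forms `P, Q ∈ ℂ[X]_D`, `P, Q ≠ 0`, `Q` a
non-zero-divisor mod `P`, and any `R ∈ ℂ[X]_D` which is a non-zero-divisor mod `(P, Q)`, there
are sets `M₁, M₂` of exponents of degree `2D` spanning complements `E₁, E₂` as in Lemma 5.1,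
and a bijection between the columns and the rows of `M_Q` (`s(2D) + #M₁ + #M₂ = s(3D)`).
[cite: Roy2013, §5, Lemma 5.1 and proof of Theorem 5.2] -/
theorem exists_phi_data {P Q R : CX} (hP : P.IsHomogeneous D) (hQ : Q.IsHomogeneous D)
    (hR : R.IsHomogeneous D) (hP0 : P ≠ 0) (hQ0 : Q ≠ 0)
    (hPQ : ∀ f : CX, Q * f ∈ Ideal.span {P} → f ∈ Ideal.span {P})
    (hPQR : ∀ f : CX, R * f ∈ Ideal.span {P, Q} → f ∈ Ideal.span {P, Q}) :
    ∃ M₁ M₂ : Finset (Fin 3 →₀ ℕ), (∀ μ ∈ M₁, μ.degree = 2 * D) ∧ (∀ μ ∈ M₂, μ.degree = 2 * D) ∧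
      Submodule.span ℂ ((fun μ => monomial μ (1 : ℂ)) '' (M₁ : Set (Fin 3 →₀ ℕ))) ⊓
        (homogeneousSubmodule (Fin 3) ℂ D).map (LinearMap.mulLeft ℂ P) = ⊥ ∧
      Submodule.span ℂ ((fun μ => monomial μ (1 : ℂ)) '' (M₁ : Set (Fin 3 →₀ ℕ))) ⊔
        (homogeneousSubmodule (Fin 3) ℂ D).map (LinearMap.mulLeft ℂ P) =
        homogeneousSubmodule (Fin 3) ℂ (2 * D) ∧
      Submodule.span ℂ ((fun μ => monomial μ (1 : ℂ)) '' (M₂ : Set (Fin 3 →₀ ℕ))) ⊓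
        ((homogeneousSubmodule (Fin 3) ℂ D).map (LinearMap.mulLeft ℂ P) ⊔
          (homogeneousSubmodule (Fin 3) ℂ D).map (LinearMap.mulLeft ℂ Q)) = ⊥ ∧
      Submodule.span ℂ ((fun μ => monomial μ (1 : ℂ)) '' (M₂ : Set (Fin 3 →₀ ℕ))) ⊔
        ((homogeneousSubmodule (Fin 3) ℂ D).map (LinearMap.mulLeft ℂ P) ⊔
          (homogeneousSubmodule (Fin 3) ℂ D).map (LinearMap.mulLeft ℂ Q)) =
        homogeneousSubmodule (Fin 3) ℂ (2 * D) ∧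
      Nonempty ((↥(finsuppAntidiag (univ : Finset (Fin 3)) (2 * D)) ⊕ (↥M₁ ⊕ ↥M₂)) ≃
        ↥(finsuppAntidiag (univ : Finset (Fin 3)) (3 * D))) := by
  classical
  have hW₁ : (homogeneousSubmodule (Fin 3) ℂ D).map (LinearMap.mulLeft ℂ P) ≤
      homogeneousSubmodule (Fin 3) ℂ (2 * D) := by
    have h := map_mulLeft_le hP D; rwa [show D + D = 2 * D by ring] at h
  have hW₂ : (homogeneousSubmodule (Fin 3) ℂ D).map (LinearMap.mulLeft ℂ P) ⊔
      (homogeneousSubmodule (Fin 3) ℂ D).map (LinearMap.mulLeft ℂ Q) ≤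
      homogeneousSubmodule (Fin 3) ℂ (2 * D) := by
    refine sup_le hW₁ ?_
    have h := map_mulLeft_le hQ D; rwa [show D + D = 2 * D by ring] at h
  obtain ⟨M₁, hM₁, hE₁i, hE₁s⟩ := exists_monomial_complement (2 * D) _ hW₁
  obtain ⟨M₂, hM₂, hE₂i, hE₂s⟩ := exists_monomial_complement (2 * D) _ hW₂
  refine ⟨M₁, M₂, hM₁, hM₂, hE₁i, hE₁s, hE₂i, hE₂s, ?_⟩
  have hspan_le : ∀ M : Finset (Fin 3 →₀ ℕ), (∀ μ ∈ M, μ.degree = 2 * D) →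
      Submodule.span ℂ ((fun μ => monomial μ (1 : ℂ)) '' (M : Set (Fin 3 →₀ ℕ))) ≤
        homogeneousSubmodule (Fin 3) ℂ (2 * D) := fun M hM =>
    Submodule.span_le.mpr (by
      rintro _ ⟨μ, hμ, rfl⟩
      exact (mem_homogeneousSubmodule _ _).mpr (isHomogeneous_monomial _ (hM μ hμ)))
  obtain ⟨-, -, hE₂⟩ := lemma_5_1 hP hQ hR hP0 hQ0 hPQ hPQR (hspan_le M₁ hM₁) hE₁i hE₁s
    (hspan_le M₂ hM₂) hE₂i hE₂s
  rw [finrank_span_monomials] at hE₂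
  -- `#M₁ + s(D) = s(2D)`
  haveI := finite_homogeneousSubmodule_fin_three (2 * D)
  haveI := finite_homogeneousSubmodule_fin_three D
  haveI : Module.Finite ℂ
      ↥(Submodule.span ℂ ((fun μ => monomial μ (1 : ℂ)) '' (M₁ : Set (Fin 3 →₀ ℕ)))) :=
    Module.Finite.span_of_finite ℂ ((M₁ : Set (Fin 3 →₀ ℕ)).toFinite.image _)
  have hE₁ := Submodule.finrank_sup_add_finrank_inf_eq
    (Submodule.span ℂ ((fun μ => monomial μ (1 : ℂ)) '' (M₁ : Set (Fin 3 →₀ ℕ))))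
    ((homogeneousSubmodule (Fin 3) ℂ D).map (LinearMap.mulLeft ℂ P))
  rw [hE₁i, hE₁s, finrank_bot, add_zero, finrank_homogeneousSubmodule_fin_three,
    finrank_map_mulLeft hP0, finrank_span_monomials] at hE₁
  refine ⟨Fintype.equivOfCardEq ?_⟩
  rw [Fintype.card_sum, Fintype.card_sum, card_finsuppAntidiag_fin_three,
    card_finsuppAntidiag_fin_three, Fintype.card_coe, Fintype.card_coe]
  have h1 := choose_identity_one D
  have h2 := choose_identity_two D
  rw [← hE₂] at h2
  omega

end Roy2013

end Literature.NumberTheory.Transcendental
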